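import Mathlib
import HarnessLib
import Literature.AlgebraicGeometry.Resolution.MvPolynomialKillVars
import Summits.ResolutionOfSingularities.ResolutionOfSingularities.Theorems.WildQuotientsWildQuotientResolutionS1aRingKillDataOfCert
import Summits.ResolutionOfSingularities.ResolutionOfSingularities.Theorems.WildQuotientsWildQuotientResolutionS1aVeroneseNormalisation

/-!
# S1a — THE FIRST INHABITANT OF `RingKillData`: the polynomial model of the census' (2,1) kill leaf with boundary `ε^m`, all `p`

[OURS · L1 W4.5c · lead-1 g10; SUCCESSOR-BRIEF v1.3 §4 item 2 / KILL-CRITERION v1 §5 (4) «FIRST INHABITANT»] — NOT statements of the manuscript;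
counted 0; AI-level work, weaker than expert review. Crux stmt-ResolutionOfSingularities-17941 `CyclicQuotientFourfolds`, line `s1a-logminvertex` v10,
K-side (`stub_killTouchReachAux`) / killability clause (`killableAt_over_of_ringKillData`, p628829).

THE NODE. `B = k[x₀, x₁, x₂, x₃]` (trivially graded), `σ` ANY ring automorphism with `σ xᵢ = xᵢ` (`i = 0, 1`), `σ x₂ = x₂ + x₁^m x₀`, `σ x₃ = x₃ + x₁^m x₂`,
`σ` the identity on constants — the smooth transversal (2,1)-type along the plane `C = V(x₀, x₂)` with boundary `β = x₁^m` (`m = 0`: the linear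
`J₃ ⊕ J₁`-block; in characteristic `p ≥ 3` these `σ` have order `p`). Centre `(x₀, x₂)` with weights `(2, 1)`.
* `exists_leafAut` — such a `σ` exists (explicit inverse);
* `isRegular_X_zero_X_two`, `isRegularRing_quotient_X_zero_X_two` — the centre is K1′-regular in `k[x₀..x₃]`
  (Literature `MvPolynomial.isWeaklyRegular_map_X`, `quotientSpanXEquiv`; Mathlib's regularity of polynomial rings);
* ★★★ `ringKillData_leaf` — `RingKillData p r B 𝒜 σ` for EVERY `p`, every `m` and every trivial grading `𝒜`: by `ringKillData_smoothTransversalType`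
  (KC2∘KC3∘KC4, p636674) with `β = x₁^m`, `h = u = 1`, (a′) checked on the generators `C k ∪ {xᵢ}`, isolation `(x₀, x₂) ≤ (augIdeal σ : x₁^m)` from the two
  increments, Veronese degree from `veroneseNormalisation` (p574007). So on EVERY σ-fixed chart `R^w[(bT^{d'})⁻¹]`, `d' > 0`, of the (2,1)-weighted
  cobordant blow-up of `(x₀, x₂)` the augmentation ideal of `σʼ` is principal (`= (x₁^m s)`): the census' generic KILL node is a theorem, for all `p`.
-/

set_option linter.dupNamespace false

noncomputable section

open Literature.AlgebraicGeometry.Resolution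
open scoped LaurentPolynomial
open MvPolynomial
open Summit.ResolutionOfSingularities.ResolutionOfSingularities.Theorems.WildQuotientResolution.S1.CoarseChart
open Summit.ResolutionOfSingularities.ResolutionOfSingularities.Theorems.WildQuotientResolution.S1.BlowupCharts

namespace Summit.ResolutionOfSingularities.ResolutionOfSingularities.Theorems.WildQuotientResolution.S1.KillCert

variable (k : Type) [Field k]

/-! ## The automorphism of the leaf -/

/-- **The leaf automorphism exists**: `x₀ ↦ x₀, x₁ ↦ x₁, x₂ ↦ x₂ + x₁^m x₀, x₃ ↦ x₃ + x₁^m x₂` extends to a `k`-algebra automorphism of `k[x₀..x₃]`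
(inverse `x₂ ↦ x₂ − x₁^m x₀`, `x₃ ↦ x₃ − x₁^m (x₂ − x₁^m x₀)`). [OURS · L1 W4.5c] -/
theorem exists_leafAut (m : ℕ) :
    ∃ σ : MvPolynomial (Fin 4) k ≃+* MvPolynomial (Fin 4) k, (∀ a : k, σ (C a) = C a) ∧
      σ (X 0) = X 0 ∧ σ (X 1) = X 1 ∧ σ (X 2) = X 2 + X 1 ^ m * X 0 ∧ σ (X 3) = X 3 + X 1 ^ m * X 2 := by
  let φ : MvPolynomial (Fin 4) k →ₐ[k] MvPolynomial (Fin 4) k :=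
    aeval ![X 0, X 1, X 2 + X 1 ^ m * X 0, X 3 + X 1 ^ m * X 2]
  let ψ : MvPolynomial (Fin 4) k →ₐ[k] MvPolynomial (Fin 4) k :=
    aeval ![X 0, X 1, X 2 - X 1 ^ m * X 0, X 3 - X 1 ^ m * (X 2 - X 1 ^ m * X 0)]
  have hφ : ∀ i, φ (X i) = (![X 0, X 1, X 2 + X 1 ^ m * X 0, X 3 + X 1 ^ m * X 2] : Fin 4 → MvPolynomial (Fin 4) k) i :=
    fun i => aeval_X _ i
  have hψ : ∀ i, ψ (X i) = (![X 0, X 1, X 2 - X 1 ^ m * X 0, X 3 - X 1 ^ m * (X 2 - X 1 ^ m * X 0)] :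
      Fin 4 → MvPolynomial (Fin 4) k) i :=
    fun i => aeval_X _ i
  have h1 : φ.comp ψ = AlgHom.id k _ := by
    refine algHom_ext fun i => ?_
    rw [AlgHom.comp_apply, AlgHom.id_apply]
    fin_cases i <;>
      simp only [hψ, Fin.zero_eta, Fin.mk_one, Fin.reduceFinMk, Matrix.cons_val_zero, Matrix.cons_val_one, Matrix.cons_val,
        map_sub, map_mul, map_pow, hφ] <;> ring
  have h2 : ψ.comp φ = AlgHom.id k _ := by
    refine algHom_ext fun i => ?_
    rw [AlgHom.comp_apply, AlgHom.id_apply]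
    fin_cases i <;>
      simp only [hφ, Fin.zero_eta, Fin.mk_one, Fin.reduceFinMk, Matrix.cons_val_zero, Matrix.cons_val_one, Matrix.cons_val,
        map_add, map_mul, map_pow, hψ] <;> ring
  refine ⟨(AlgEquiv.ofAlgHom φ ψ h1 h2).toRingEquiv, fun a => ?_, ?_, ?_, ?_, ?_⟩
  · exact φ.commutes a
  all_goals
    change φ (X _) = _
    rw [hφ]
    simp

/-! ## The centre `(x₀, x₂)` is K1′-regular -/

/-- `(x₀, x₂)` is a regular sequence on `k[x₀..x₃]` (distinct variables are weakly regular; the ideal is proper). [OURS · L1 W4.5c] -/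
theorem isRegular_X_zero_X_two :
    RingTheory.Sequence.IsRegular (MvPolynomial (Fin 4) k) (List.ofFn (![X 0, X 2] : Fin 2 → MvPolynomial (Fin 4) k)) := by
  have hl : List.ofFn (![X 0, X 2] : Fin 2 → MvPolynomial (Fin 4) k) = ([0, 2] : List (Fin 4)).map X := by
    simp [List.ofFn_succ]
  rw [hl]
  refine ⟨isWeaklyRegular_map_X (R := k) [0, 2] (by decide), ?_⟩
  intro htop
  rw [smul_eq_mul, Ideal.mul_top] at htop
  have h1 : (1 : MvPolynomial (Fin 4) k) ∈ Ideal.ofList (([0, 2] : List (Fin 4)).map (X : Fin 4 → MvPolynomial (Fin 4) k)) := by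
    rw [← htop]; trivial
  have hle : Ideal.ofList (([0, 2] : List (Fin 4)).map (X : Fin 4 → MvPolynomial (Fin 4) k)) ≤
      RingHom.ker (constantCoeff : MvPolynomial (Fin 4) k →+* k) := by
    rw [Ideal.ofList, Ideal.span_le]
    intro x hx
    simp only [List.map_cons, List.map_nil, List.mem_cons, List.not_mem_nil, or_false, Set.mem_setOf_eq] at hx
    rcases hx with rfl | rfl <;> simp [RingHom.mem_ker, constantCoeff_X]
  have := hle h1
  rw [RingHom.mem_ker, map_one] at this
  exact one_ne_zero this

/-- `Set.range ![x₀, x₂] = X '' {0, 2}`. -/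
theorem range_X_zero_X_two :
    Set.range (![X 0, X 2] : Fin 2 → MvPolynomial (Fin 4) k) = X '' ({0, 2} : Set (Fin 4)) := by
  ext x
  simp only [Set.mem_range, Set.mem_image, Set.mem_insert_iff, Set.mem_singleton_iff]
  constructor
  · rintro ⟨i, rfl⟩
    fin_cases i
    · exact ⟨0, Or.inl rfl, rfl⟩
    · exact ⟨2, Or.inr rfl, rfl⟩
  · rintro ⟨j, rfl | rfl, rfl⟩
    · exact ⟨0, rfl⟩
    · exact ⟨1, rfl⟩

/-- `k[x₀..x₃]/(x₀, x₂) ≅ k[x₁, x₃]` is a regular ring. [OURS · L1 W4.5c] -/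
theorem isRegularRing_quotient_X_zero_X_two :
    IsRegularRing (MvPolynomial (Fin 4) k ⧸ Ideal.span (Set.range (![X 0, X 2] : Fin 2 → MvPolynomial (Fin 4) k))) := by
  rw [range_X_zero_X_two]
  haveI : IsRegularRing (MvPolynomial {j : Fin 4 // j ∉ ({0, 2} : Set (Fin 4))} k) := inferInstance
  exact IsRegularRing.of_ringEquiv (quotientSpanXEquiv (R := k) ({0, 2} : Set (Fin 4))).toRingEquiv.symm

/-- `k[x₀..x₃]` is generated as a ring by the constants and the variables. -/
theorem closure_range_C_union_range_X :
    Subring.closure (Set.range (C : k → MvPolynomial (Fin 4) k) ∪ Set.range (X : Fin 4 → MvPolynomial (Fin 4) k)) = ⊤ := by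
  have h := Algebra.adjoin_eq_ring_closure (R := k) (Set.range (X : Fin 4 → MvPolynomial (Fin 4) k))
  rw [adjoin_range_X] at h
  rw [← show (algebraMap k (MvPolynomial (Fin 4) k) : k → MvPolynomial (Fin 4) k) = C from rfl, ← h]
  rfl

/-! ## The kill -/

/-- ★★★ **THE CENSUS' (2,1) KILL LEAF IS A THEOREM, FOR ALL `p`.** On `B = k[x₀, x₁, x₂, x₃]` with ANY trivial grading `𝒜`, let `σ` be a ring automorphism
fixing the constants, `x₀` and `x₁`, with `σ x₂ = x₂ + x₁^m x₀` and `σ x₃ = x₃ + x₁^m x₂` (`m ≥ 0`; `m = 0` is the linear `J₃ ⊕ J₁` block). Then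
`RingKillData p r B 𝒜 σ`: for the centre `(x₀, x₂)` with weights `(2, 1)` (K1′-regular, σ-adapted, with a Veronese degree), on EVERY σ-fixed chart
`R^w[(b T^{d'})⁻¹]`, `d' > 0`, of the weighted cobordant blow-up the augmentation ideal of `σʼ` is principal (it is `(x₁^m · s)`, KC1) — the bad plane
`C = V(x₀, x₂)` with boundary `ε^m = x₁^m` is KILLED by one (2,1)-move. First inhabitant of `RingKillData` (p628829); proof = KC2∘KC3∘KC4
(`ringKillData_smoothTransversalType`) with `β = x₁^m`, `h = u = 1`. [OURS · L1 W4.5c · SUCCESSOR-BRIEF v1.3 §4 item 2; NOT a statement of the manuscript] -/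
theorem ringKillData_leaf (p : ℕ) (r : Fin 0 → ℕ) (m : ℕ)
    (𝒜 : (Π j : Fin 0, ZMod (r j)) → AddSubgroup (MvPolynomial (Fin 4) k)) [GradedRing 𝒜] (h𝒜 : ∀ i, 𝒜 i = ⊤)
    (σ : MvPolynomial (Fin 4) k ≃+* MvPolynomial (Fin 4) k) (hC : ∀ a : k, σ (C a) = C a)
    (h0 : σ (X 0) = X 0) (h1 : σ (X 1) = X 1) (h2 : σ (X 2) = X 2 + X 1 ^ m * X 0) (h3 : σ (X 3) = X 3 + X 1 ^ m * X 2) :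
    RingKillData p r (MvPolynomial (Fin 4) k) 𝒜 σ := by
  classical
  -- the centre and the boundary
  let f : Fin 2 → MvPolynomial (Fin 4) k := ![X 0, X 2]
  let β : MvPolynomial (Fin 4) k := X 1 ^ m
  have hf0 : f 0 = X 0 := rfl
  have hf1 : f 1 = X 2 := rfl
  have hf : ∀ i, f i ∈ 𝒜 ((fun _ => 0) i) := fun i => by rw [h𝒜]; trivial
  -- Veronese degree (T2 is trivial for the trivial grading)
  have hT2 : ∃ t : Finset (MvPolynomial (Fin 4) k),
      Subring.closure (((𝒜 0 : AddSubgroup (MvPolynomial (Fin 4) k)) : Set (MvPolynomial (Fin 4) k)) ∪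
        (↑t : Set (MvPolynomial (Fin 4) k))) = ⊤ := by
    refine ⟨∅, ?_⟩
    rw [h𝒜 0, Finset.coe_empty, Set.union_empty]
    exact top_le_iff.mp fun x _ => Subring.subset_closure trivial
  obtain ⟨d, hver⟩ := Veronese.veroneseNormalisation _ _ 𝒜 hT2 2 f (fun _ => 0) ![2, 1] hf
  -- the two increments
  have hX0 : X 0 ∈ (weightedFiltration f ![2, 1]).ideal 1 :=
    (weightedFiltration f ![2, 1]).antitone (by norm_num : 1 ≤ 2) (mem_weightedFiltration_ideal f ![2, 1] 0)
  have hX2 : X 2 ∈ (weightedFiltration f ![2, 1]).ideal 1 := mem_weightedFiltration_ideal f ![2, 1] 1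
  have hinc2 : σ (X 2) - X 2 = β * X 0 := by rw [h2]; ring
  have hinc3 : σ (X 3) - X 3 = β * X 2 := by rw [h3]; ring
  refine ringKillData_smoothTransversalType r (MvPolynomial (Fin 4) k) 𝒜 σ f (fun _ => 0) d hf
    (isRegular_X_zero_X_two k) (isRegularRing_quotient_X_zero_X_two k) hver β (X 3) 1 1 isUnit_one isUnit_one
    (Set.range (C : k → MvPolynomial (Fin 4) k) ∪ Set.range (X : Fin 4 → MvPolynomial (Fin 4) k))
    (closure_range_C_union_range_X k) ?_ ?_ ?_ ?_ ?_
  · -- (a′) on the generators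
    rintro g (⟨a, rfl⟩ | ⟨i, rfl⟩)
    · rw [hC, sub_self]; exact Ideal.zero_mem _
    · fin_cases i
      · rw [Fin.zero_eta, h0, sub_self]; exact Ideal.zero_mem _
      · rw [Fin.mk_one, h1, sub_self]; exact Ideal.zero_mem _
      · change σ (X 2) - X 2 ∈ _
        rw [hinc2]; exact Ideal.mul_mem_mul (Ideal.mem_span_singleton_self β) hX0
      · change σ (X 3) - X 3 ∈ _
        rw [hinc3]; exact Ideal.mul_mem_mul (Ideal.mem_span_singleton_self β) hX2
  · -- `σ x₀ = x₀`
    rw [hf0, h0, sub_self]; exact Ideal.zero_mem _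
  · -- isolation: `x₀ β, x₂ β` are increments
    refine ⟨1, ?_⟩
    rw [pow_one, Ideal.span_le]
    rintro _ ⟨i, rfl⟩
    rw [SetLike.mem_coe, Ideal.mem_colon_span_singleton]
    fin_cases i
    · change f 0 * β ∈ _
      rw [hf0, mul_comm, ← hinc2]; exact sub_mem_augmentationIdeal σ _
    · change f 1 * β ∈ _
      rw [hf1, mul_comm, ← hinc3]; exact sub_mem_augmentationIdeal σ _
  · -- `in₂ θ(x₂) = x̄₀ʼ`
    rw [hf1, hf0, hinc2, mul_one, sub_self]; exact Ideal.zero_mem _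
  · -- `in₁ θ(x₃) = x̄₂ʼ`
    rw [hf1, hinc3, mul_one, sub_self]; exact Ideal.zero_mem _

/-- **… so the leaf node with ITS OWN automorphism is an inhabitant of `RingKillData`** (non-vacuity: `exists_leafAut`). [OURS · L1 W4.5c] -/
theorem exists_ringKillData_leaf (p : ℕ) (r : Fin 0 → ℕ) (m : ℕ)
    (𝒜 : (Π j : Fin 0, ZMod (r j)) → AddSubgroup (MvPolynomial (Fin 4) k)) [GradedRing 𝒜] (h𝒜 : ∀ i, 𝒜 i = ⊤) :
    ∃ σ : MvPolynomial (Fin 4) k ≃+* MvPolynomial (Fin 4) k,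
      σ (X 2) = X 2 + X 1 ^ m * X 0 ∧ σ (X 3) = X 3 + X 1 ^ m * X 2 ∧ RingKillData p r (MvPolynomial (Fin 4) k) 𝒜 σ := by
  obtain ⟨σ, hC, h0, h1, h2, h3⟩ := exists_leafAut k m
  exact ⟨σ, h2, h3, ringKillData_leaf k p r m 𝒜 h𝒜 σ hC h0 h1 h2 h3⟩

end Summit.ResolutionOfSingularities.ResolutionOfSingularities.Theorems.WildQuotientResolution.S1.KillCert

end
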